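import Summits.Ventures.HodgeRepro2.T5SU11FibrationHaar
import Summits.Ventures.HodgeRepro2.T5SU11BorelTransitive

/-!
# The Haar measure of `SU(1,1)` in Iwasawa coordinates `g = n_s a_t k`

`T5SU11FibrationHaar` realises a Haar measure of `SU(1,1)` as `ν = Φ_* (poincare ⊗ μ_K)` with
`Φ (z, u) = s(z) · rot u`. Here the disc is re-parametrised by the Iwasawa coordinates
`(s, t) ↦ (n_s a_t) · 0` (a bijection `ℝ × ℝ → 𝔻`, `T5SU11BorelTransitive`), packed as
`ζ = s + i t ∈ ℂ` (`iwasawaOrbit ζ = orbit (n_{Re ζ} a_{Im ζ})`). In the right-half-plane coordinate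
`w = (1 + z)/(1 - z)` this point is `w = e^{2t} - 2 i s` (`iwasawaOrbit_eq`), so the map is the
composite of `ζ ↦ e^{2 Im ζ} - 2 i Re ζ` (real Jacobian `4 e^{2t}`) with the holomorphic Möbius map
`w ↦ (w - 1)/(w + 1)` (real Jacobian `|2/(w+1)²|²`); against the Poincaré density the total
Jacobian is `e^{-2t}` (`abs_det_mul_dens`). Mathlib's change of variables on `ℂ = ℝ²` then gives,
with no integrability hypothesis,
`∫_𝔻 (1 - |z|²)⁻² G(z) dA(z) = ∫_{ℝ²} e^{-2t} G((n_s a_t) · 0) ds dt`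
(`lintegral_poincare`, `integral_poincare`), and for the group
`∫_{SU(1,1)} f dν = ∫_{ℝ²} e^{-2t} (∫_K f (n_s a_t k) dk) ds dt`
(`lintegral_nu`, `integral_nu`, `integral_haar` for an arbitrary Haar measure up to the scalar of
the fibration theorem): **the Haar measure of `SU(1,1)` in the coordinates `n_s a_t k` is
`e^{-2t} ds dt dk`.** Nothing is claimed about (N).

Blind lane: Mathlib + the HodgeRepro2 prefix only; no sorry; axioms ⊆ {propext, Classical.choice,
Quot.sound}.
-/

namespace Summit.Ventures.HodgeRepro2.T5SU11IwasawaHaar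

open MeasureTheory MeasureTheory.Measure Metric Filter Topology Set Complex
open T5UnitaryBound T5PoincareDensity T5PoincareInvariance T5PoincareMeasure T5SU11Unimodular
  T5SU11Fibration T5SU11FibrationHaar T5SU11Cartan T5SU11OneParameter T5BergmanCoefficient
  T5SU11HyperbolicSubgroup T5SU11UnipotentSubgroup T5SU11BorelSubgroup T5SU11Iwasawa
  T5SU11IwasawaUnique T5SU11BorelTransitive
open scoped ENNReal NNReal

/-! ### The Iwasawa parametrisation of the disc and its half-plane form -/

/-- The Iwasawa parametrisation of the disc, `ζ = s + i t ↦ (n_s a_t) · 0`. -/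
noncomputable def iwasawaOrbit (ζ : ℂ) : ℂ := orbit (unip ζ.re * hyp ζ.im)

/-- The half-plane point `w(ζ) = e^{2t} - 2 i s` (`ζ = s + i t`). -/
noncomputable def iwasawaHalf (ζ : ℂ) : ℂ :=
  ((Real.exp (2 * ζ.im) : ℝ) : ℂ) - ((2 * ζ.re : ℝ) : ℂ) * I

/-- The Möbius map `w ↦ (w - 1)/(w + 1)` from the right half-plane to the disc. -/
noncomputable def cayleyDisc (w : ℂ) : ℂ := (w - 1) / (w + 1)

/-- `Re w(ζ) = e^{2t}`. -/
lemma iwasawaHalf_re (ζ : ℂ) : (iwasawaHalf ζ).re = Real.exp (2 * ζ.im) := by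
  simp only [iwasawaHalf, Complex.sub_re, Complex.ofReal_re, Complex.mul_re, Complex.ofReal_im,
    Complex.I_re, Complex.I_im]
  ring

/-- `Im w(ζ) = -2s`. -/
lemma iwasawaHalf_im (ζ : ℂ) : (iwasawaHalf ζ).im = -(2 * ζ.re) := by
  simp only [iwasawaHalf, Complex.sub_im, Complex.ofReal_im, Complex.mul_im, Complex.ofReal_re,
    Complex.I_re, Complex.I_im]
  ring

/-- `w(ζ) + 1 ≠ 0` (its real part is `e^{2t} + 1 > 0`). -/
lemma iwasawaHalf_add_one_ne_zero (ζ : ℂ) : iwasawaHalf ζ + 1 ≠ 0 := by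
  intro h
  have := congrArg Complex.re h
  rw [Complex.add_re, iwasawaHalf_re, Complex.one_re, Complex.zero_re] at this
  linarith [Real.exp_pos (2 * ζ.im)]

/-- `tanh t = (e^{2t} - 1)/(e^{2t} + 1)`. -/
lemma tanh_eq_exp (t : ℝ) : Real.tanh t = (Real.exp (2 * t) - 1) / (Real.exp (2 * t) + 1) := by
  rw [Real.tanh_eq_sinh_div_cosh, Real.sinh_eq, Real.cosh_eq, Real.exp_neg, two_mul, Real.exp_add]
  have h := Real.exp_pos t
  field_simp

/-- **The Iwasawa orbit in the half-plane coordinate**: `(n_s a_t) · 0 = (w - 1)/(w + 1)` with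
`w = e^{2t} - 2 i s`. -/
theorem iwasawaOrbit_eq (ζ : ℂ) : iwasawaOrbit ζ = cayleyDisc (iwasawaHalf ζ) := by
  unfold iwasawaOrbit cayleyDisc iwasawaHalf
  rw [orbit_unip_mul_hyp, tanh_eq_exp]
  have hE : 0 < Real.exp (2 * ζ.im) := Real.exp_pos _
  have hD := denom_ne_zero ζ.re ((Real.exp (2 * ζ.im) - 1) / (Real.exp (2 * ζ.im) + 1))
  generalize Real.exp (2 * ζ.im) = e at hE hD ⊢
  generalize ζ.re = s at hD ⊢
  have hE' : (e : ℂ) + 1 ≠ 0 := by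
    intro h
    have := congrArg Complex.re h
    rw [Complex.add_re, Complex.ofReal_re, Complex.one_re, Complex.zero_re] at this
    linarith
  have hD2 : (e : ℂ) - ((2 * s : ℝ) : ℂ) * I + 1 ≠ 0 := by
    intro h
    have := congrArg Complex.re h
    rw [Complex.add_re, Complex.sub_re, Complex.ofReal_re, Complex.mul_re, Complex.ofReal_re,
      Complex.ofReal_im, Complex.I_re, Complex.I_im, Complex.one_re, Complex.zero_re] at this
    linarith
  push_cast at hD hD2 ⊢
  rw [div_eq_div_iff hD hD2]
  field_simp
  ring

/-! ### The derivative and its Jacobian -/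

/-- The real derivative of `ζ ↦ w(ζ)`: `η ↦ 2 e^{2t} Im η - 2 i Re η`. -/
noncomputable def iwasawaHalfDeriv (ζ : ℂ) : ℂ →L[ℝ] ℂ :=
  Complex.ofRealCLM.comp (Real.exp (2 * ζ.im) • ((2 : ℝ) • Complex.imCLM)) -
    I • Complex.ofRealCLM.comp ((2 : ℝ) • Complex.reCLM)

/-- The derivative `dw` applied to `η`: `2 e^{2t} Im η - 2 i Re η`. -/
lemma iwasawaHalfDeriv_apply (ζ η : ℂ) :
    iwasawaHalfDeriv ζ η =
      ((Real.exp (2 * ζ.im) * (2 * η.im) : ℝ) : ℂ) - I * ((2 * η.re : ℝ) : ℂ) := by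
  simp only [iwasawaHalfDeriv, _root_.sub_apply, ContinuousLinearMap.comp_apply,
    _root_.smul_apply, Complex.ofRealCLM_apply, Complex.imCLM_apply,
    Complex.reCLM_apply, smul_eq_mul]

/-- `ζ ↦ w(ζ)` is real-differentiable with derivative `iwasawaHalfDeriv ζ`. -/
lemma hasFDerivAt_iwasawaHalf (ζ : ℂ) : HasFDerivAt iwasawaHalf (iwasawaHalfDeriv ζ) ζ := by
  have hg : HasFDerivAt (fun ζ : ℂ => 2 * ζ.im) ((2 : ℝ) • Complex.imCLM) ζ :=
    Complex.imCLM.hasFDerivAt.const_mul 2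
  have he : HasFDerivAt (fun ζ : ℂ => Real.exp (2 * ζ.im))
      (Real.exp (2 * ζ.im) • ((2 : ℝ) • Complex.imCLM)) ζ :=
    (Real.hasDerivAt_exp _).comp_hasFDerivAt ζ hg
  have h1 : HasFDerivAt (fun ζ : ℂ => ((Real.exp (2 * ζ.im) : ℝ) : ℂ))
      (Complex.ofRealCLM.comp (Real.exp (2 * ζ.im) • ((2 : ℝ) • Complex.imCLM))) ζ :=
    Complex.ofRealCLM.hasFDerivAt.comp ζ he
  have hr : HasFDerivAt (fun ζ : ℂ => ((2 * ζ.re : ℝ) : ℂ))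
      (Complex.ofRealCLM.comp ((2 : ℝ) • Complex.reCLM)) ζ :=
    Complex.ofRealCLM.hasFDerivAt.comp ζ (Complex.reCLM.hasFDerivAt.const_mul 2)
  have h2 : HasFDerivAt (fun ζ : ℂ => ((2 * ζ.re : ℝ) : ℂ) * I)
      (I • Complex.ofRealCLM.comp ((2 : ℝ) • Complex.reCLM)) ζ :=
    hr.mul_const I
  exact h1.sub h2

/-- The real Jacobian of `ζ ↦ w(ζ)` is `4 e^{2t}`. -/
theorem det_iwasawaHalfDeriv (ζ : ℂ) : (iwasawaHalfDeriv ζ).det = 4 * Real.exp (2 * ζ.im) := by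
  show LinearMap.det ((iwasawaHalfDeriv ζ : ℂ →L[ℝ] ℂ) : ℂ →ₗ[ℝ] ℂ) = _
  rw [← LinearMap.det_toMatrix Complex.basisOneI, Matrix.det_fin_two]
  simp only [LinearMap.toMatrix_apply, ContinuousLinearMap.coe_coe, Complex.coe_basisOneI,
    Complex.coe_basisOneI_repr, iwasawaHalfDeriv_apply, Matrix.cons_val_zero, Matrix.cons_val_one,
    Complex.one_re, Complex.one_im, Complex.I_re, Complex.I_im, Complex.sub_re,
    Complex.sub_im, Complex.ofReal_re, Complex.ofReal_im, Complex.mul_re, Complex.mul_im]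
  ring

/-- The derivative of `w ↦ (w - 1)/(w + 1)`: `2/(w + 1)²`. -/
lemma hasDerivAt_cayleyDisc {w : ℂ} (hw : w + 1 ≠ 0) :
    HasDerivAt cayleyDisc (2 / (w + 1) ^ 2) w := by
  have h := ((hasDerivAt_id w).sub_const 1).div ((hasDerivAt_id w).add_const 1) hw
  refine h.congr_deriv ?_
  simp only [id_eq]
  rw [div_left_inj' (pow_ne_zero 2 hw)]
  ring

/-- The real derivative of the Iwasawa parametrisation: `(2/(w + 1)²) ∘ (dw)`. -/
noncomputable def iwasawaOrbitDeriv (ζ : ℂ) : ℂ →L[ℝ] ℂ :=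
  ((ContinuousLinearMap.toSpanSingleton ℂ (2 / (iwasawaHalf ζ + 1) ^ 2)).restrictScalars ℝ).comp
    (iwasawaHalfDeriv ζ)

/-- **The Iwasawa parametrisation is real-differentiable** with derivative `iwasawaOrbitDeriv ζ`
(chain rule through the half-plane coordinate). -/
theorem hasFDerivAt_iwasawaOrbit (ζ : ℂ) : HasFDerivAt iwasawaOrbit (iwasawaOrbitDeriv ζ) ζ := by
  have e : iwasawaOrbit = cayleyDisc ∘ iwasawaHalf := funext iwasawaOrbit_eq
  rw [e]
  exact ((hasDerivAt_cayleyDisc (iwasawaHalf_add_one_ne_zero ζ)).hasFDerivAt.restrictScalars ℝ).comp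
    ζ (hasFDerivAt_iwasawaHalf ζ)

/-- The real Jacobian of the Iwasawa parametrisation: `|2/(w+1)²|² · 4 e^{2t}`. -/
theorem det_iwasawaOrbitDeriv (ζ : ℂ) :
    (iwasawaOrbitDeriv ζ).det =
      Complex.normSq (2 / (iwasawaHalf ζ + 1) ^ 2) * (4 * Real.exp (2 * ζ.im)) := by
  rw [← det_restrictScalars_toSpanSingleton, ← det_iwasawaHalfDeriv]
  show LinearMap.det ((iwasawaOrbitDeriv ζ : ℂ →L[ℝ] ℂ) : ℂ →ₗ[ℝ] ℂ) = _
  unfold iwasawaOrbitDeriv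
  rw [ContinuousLinearMap.toLinearMap_comp, LinearMap.det_comp]

/-- `1 - |(w-1)/(w+1)|² = 4 Re w / |w + 1|²`. -/
lemma one_sub_normSq_cayleyDisc {w : ℂ} (hw : w + 1 ≠ 0) :
    1 - Complex.normSq (cayleyDisc w) = 4 * w.re / Complex.normSq (w + 1) := by
  have hN : Complex.normSq (w + 1) ≠ 0 := (Complex.normSq_pos.2 hw).ne'
  have h : Complex.normSq (w - 1) = Complex.normSq (w + 1) - 4 * w.re := by
    simp only [Complex.normSq_apply, Complex.sub_re, Complex.sub_im, Complex.add_re, Complex.add_im,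
      Complex.one_re, Complex.one_im, sub_zero, add_zero]
    ring
  unfold cayleyDisc
  rw [Complex.normSq_div, h]
  field_simp
  ring

/-- **The Jacobian identity**: `|det| · dens ((n_s a_t) · 0) = e^{-2t}`. -/
theorem abs_det_mul_dens (ζ : ℂ) :
    |(iwasawaOrbitDeriv ζ).det| * dens (iwasawaOrbit ζ) = Real.exp (-(2 * ζ.im)) := by
  rw [det_iwasawaOrbitDeriv, abs_of_nonneg (mul_nonneg (Complex.normSq_nonneg _) (by positivity)),
    iwasawaOrbit_eq]
  have hw := iwasawaHalf_add_one_ne_zero ζ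
  have hN : 0 < Complex.normSq (iwasawaHalf ζ + 1) := Complex.normSq_pos.2 hw
  have hR : (iwasawaHalf ζ).re = Real.exp (2 * ζ.im) := iwasawaHalf_re ζ
  have hE : 0 < Real.exp (2 * ζ.im) := Real.exp_pos _
  have h2 : Complex.normSq (2 / (iwasawaHalf ζ + 1) ^ 2) = 4 / Complex.normSq (iwasawaHalf ζ + 1) ^ 2 := by
    rw [Complex.normSq_div, map_pow, Complex.normSq_ofNat]
    norm_num
  unfold dens
  rw [one_sub_normSq_cayleyDisc hw, h2, hR, Real.exp_neg]
  generalize Complex.normSq (iwasawaHalf ζ + 1) = N at hN ⊢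
  generalize Real.exp (2 * ζ.im) = R at hE ⊢
  have hN0 : N ≠ 0 := hN.ne'
  have hR0 : R ≠ 0 := hE.ne'
  field_simp

/-! ### The Iwasawa parametrisation is a bijection `ℂ ≅ ℝ² → 𝔻` -/

/-- The Iwasawa parametrisation is injective (`T5SU11BorelTransitive.orbit_unip_mul_hyp_injective`). -/
lemma iwasawaOrbit_injOn : Set.InjOn iwasawaOrbit Set.univ := by
  intro ζ _ ζ' _ h
  obtain ⟨hs, ht⟩ := orbit_unip_mul_hyp_injective h
  exact Complex.ext hs ht

/-- The Iwasawa parametrisation is onto the disc: `iwasawaOrbit '' ℂ = 𝔻`. -/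
lemma iwasawaOrbit_image_univ : iwasawaOrbit '' Set.univ = ball (0 : ℂ) 1 := by
  ext z
  constructor
  · rintro ⟨ζ, -, rfl⟩
    exact orbit_mem_ball _
  · intro hz
    obtain ⟨s, t, h⟩ := exists_orbit_unip_mul_hyp_eq hz
    exact ⟨⟨s, t⟩, Set.mem_univ _, h⟩

/-! ### The Poincaré measure in Iwasawa coordinates -/

/-- **The Poincaré measure in Iwasawa coordinates (`lintegral` form)**: for every `G : ℂ → ℝ≥0∞`,
`∫_𝔻 (1 - |z|²)⁻² G(z) dA(z) = ∫_ℂ e^{-2 Im ζ} G((n_{Re ζ} a_{Im ζ}) · 0) dζ`. -/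
theorem lintegral_poincare (G : ℂ → ℝ≥0∞) :
    ∫⁻ z, G z ∂poincare =
      ∫⁻ ζ, ENNReal.ofReal (Real.exp (-(2 * ζ.im))) * G (iwasawaOrbit ζ) := by
  have hfin : ∀ᵐ z ∂(volume.restrict (ball (0 : ℂ) 1)), ENNReal.ofReal (dens z) < ∞ :=
    ae_of_all _ fun z => ENNReal.ofReal_lt_top
  rw [poincare, lintegral_withDensity_eq_lintegral_mul_non_measurable _
    measurable_dens.ennreal_ofReal hfin, ← iwasawaOrbit_image_univ,
    lintegral_image_eq_lintegral_abs_det_fderiv_mul volume MeasurableSet.univ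
      (fun ζ _ => (hasFDerivAt_iwasawaOrbit ζ).hasFDerivWithinAt) iwasawaOrbit_injOn,
    Measure.restrict_univ]
  refine lintegral_congr fun ζ => ?_
  simp only [Pi.mul_apply]
  rw [← mul_assoc, ← ENNReal.ofReal_mul (abs_nonneg _), abs_det_mul_dens]

/-- **The Poincaré measure in Iwasawa coordinates (Bochner form, no integrability hypothesis)**. -/
theorem integral_poincare {E : Type*} [NormedAddCommGroup E] [NormedSpace ℝ E] [CompleteSpace E]
    (G : ℂ → E) :
    ∫ z, G z ∂poincare = ∫ ζ, Real.exp (-(2 * ζ.im)) • G (iwasawaOrbit ζ) := by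
  have hd : Measurable fun z : ℂ => Real.toNNReal (dens z) := measurable_dens.real_toNNReal
  have e : poincare = (volume.restrict (ball 0 1)).withDensity
      fun z => ((Real.toNNReal (dens z) : ℝ≥0) : ℝ≥0∞) := rfl
  rw [e, integral_withDensity_eq_integral_smul hd, ← iwasawaOrbit_image_univ,
    integral_image_eq_integral_abs_det_fderiv_smul volume MeasurableSet.univ
      (fun ζ _ => (hasFDerivAt_iwasawaOrbit ζ).hasFDerivWithinAt) iwasawaOrbit_injOn,
    Measure.restrict_univ]
  congr 1
  funext ζ
  rw [NNReal.smul_def, Real.coe_toNNReal _ (dens_nonneg _), smul_smul, abs_det_mul_dens]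

/-! ### The Haar measure of `SU(1,1)` in the coordinates `n_s a_t k` -/

/-- Every `g` is `s(g · 0) · rot v` for some `v ∈ K`. -/
lemma exists_sec_mul_rot (g : SU11) : ∃ v : Circle, g = sec (orbit g) * rot v := by
  have hz : orbit g ∈ ball (0 : ℂ) 1 := orbit_mem_ball g
  set h := (sec (orbit g))⁻¹ * g with hh
  have horb : orbit h = 0 := by
    rw [hh, orbit_mul]
    calc mobius (((sec (orbit g))⁻¹ : SU11) : Matrix (Fin 2) (Fin 2) ℂ) (orbit g)
        = mobius (((sec (orbit g))⁻¹ : SU11) : Matrix (Fin 2) (Fin 2) ℂ) (orbit (sec (orbit g))) := by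
          rw [orbit_sec hz]
      _ = orbit ((sec (orbit g))⁻¹ * sec (orbit g)) := (orbit_mul _ _).symm
      _ = 0 := by rw [inv_mul_cancel, orbit_one]
  obtain ⟨v, hv⟩ := exists_rot_of_orbit_eq_zero h horb
  refine ⟨v, ?_⟩
  rw [← hv, hh, mul_inv_cancel_left]

section measure

variable [MeasurableSpace Circle] [BorelSpace Circle] (μC : Measure Circle) [IsHaarMeasure μC]

/-- The `K`-integral does not see the choice of section: `∫_K F (s(z) k) dk = ∫_K F (n_s a_t k) dk`
for `z = (n_s a_t) · 0`. -/
lemma lintegral_fib_iwasawaOrbit (F : SU11 → ℝ≥0∞) (ζ : ℂ) :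
    ∫⁻ u, F (fib (iwasawaOrbit ζ, u)) ∂μC = ∫⁻ u, F (unip ζ.re * hyp ζ.im * rot u) ∂μC := by
  obtain ⟨v, hv⟩ := exists_sec_mul_rot (unip ζ.re * hyp ζ.im)
  have hv' : unip ζ.re * hyp ζ.im = sec (iwasawaOrbit ζ) * rot v := hv
  calc ∫⁻ u, F (fib (iwasawaOrbit ζ, u)) ∂μC
      = ∫⁻ u, F (unip ζ.re * hyp ζ.im * rot (v⁻¹ * u)) ∂μC := by
        refine lintegral_congr fun u => ?_
        show F (sec (iwasawaOrbit ζ) * rot u) = F (unip ζ.re * hyp ζ.im * rot (v⁻¹ * u))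
        rw [hv', map_mul, map_inv, mul_assoc, mul_inv_cancel_left]
    _ = ∫⁻ u, F (unip ζ.re * hyp ζ.im * rot u) ∂μC :=
        lintegral_mul_left_eq_self (fun u => F (unip ζ.re * hyp ζ.im * rot u)) v⁻¹

/-- **The Haar measure `ν = Φ_*(poincare ⊗ μ_K)` in Iwasawa coordinates (`lintegral` form)**:
`∫_G F dν = ∫_ℂ e^{-2 Im ζ} (∫_K F (n_{Re ζ} a_{Im ζ} k) dk) dζ` for every measurable `F`. -/
theorem lintegral_nu (F : SU11 → ℝ≥0∞) (hF : Measurable F) :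
    ∫⁻ g, F g ∂(nu μC) =
      ∫⁻ ζ : ℂ, ENNReal.ofReal (Real.exp (-(2 * ζ.im))) *
        ∫⁻ u, F (unip ζ.re * hyp ζ.im * rot u) ∂μC := by
  rw [nu, lintegral_map hF measurable_fib,
    lintegral_prod (fun p => F (fib p)) (hF.comp measurable_fib).aemeasurable, lintegral_poincare]
  refine lintegral_congr fun ζ => ?_
  rw [lintegral_fib_iwasawaOrbit]

/-- The Bochner form of `lintegral_fib_iwasawaOrbit`. -/
lemma integral_fib_iwasawaOrbit {E : Type*} [NormedAddCommGroup E] [NormedSpace ℝ E]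
    (f : SU11 → E) (ζ : ℂ) :
    ∫ u, f (fib (iwasawaOrbit ζ, u)) ∂μC = ∫ u, f (unip ζ.re * hyp ζ.im * rot u) ∂μC := by
  obtain ⟨v, hv⟩ := exists_sec_mul_rot (unip ζ.re * hyp ζ.im)
  have hv' : unip ζ.re * hyp ζ.im = sec (iwasawaOrbit ζ) * rot v := hv
  calc ∫ u, f (fib (iwasawaOrbit ζ, u)) ∂μC
      = ∫ u, f (unip ζ.re * hyp ζ.im * rot (v⁻¹ * u)) ∂μC := by
        congr 1
        funext u
        show f (sec (iwasawaOrbit ζ) * rot u) = f (unip ζ.re * hyp ζ.im * rot (v⁻¹ * u))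
        rw [hv', map_mul, map_inv, mul_assoc, mul_inv_cancel_left]
    _ = ∫ u, f (unip ζ.re * hyp ζ.im * rot u) ∂μC :=
        integral_mul_left_eq_self (fun u => f (unip ζ.re * hyp ζ.im * rot u)) v⁻¹

/-- **The Haar measure `ν` in Iwasawa coordinates (Bochner form)**: for `ν`-integrable `f`,
`∫_G f dν = ∫_ℂ e^{-2 Im ζ} • (∫_K f (n_{Re ζ} a_{Im ζ} k) dk) dζ`. -/
theorem integral_nu {E : Type*} [NormedAddCommGroup E] [NormedSpace ℝ E] [CompleteSpace E]
    (f : SU11 → E) (hf : Integrable f (nu μC)) :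
    ∫ g, f g ∂(nu μC) =
      ∫ ζ : ℂ, Real.exp (-(2 * ζ.im)) • ∫ u, f (unip ζ.re * hyp ζ.im * rot u) ∂μC := by
  have hint' : Integrable (f ∘ fib) (poincare.prod μC) :=
    (integrable_map_measure hf.aestronglyMeasurable measurable_fib.aemeasurable).mp hf
  have h2 : ∫ g, f g ∂(nu μC) = ∫ p, f (fib p) ∂(poincare.prod μC) :=
    integral_map measurable_fib.aemeasurable hf.aestronglyMeasurable
  rw [h2, integral_prod (fun p => f (fib p)) hint', integral_poincare]
  congr 1
  funext ζ
  rw [integral_fib_iwasawaOrbit]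

/-- **The Haar measure of `SU(1,1)` in Iwasawa coordinates**: for every Haar measure `μ` and every
`μ`-integrable `f`, with `c = haarScalarFactor ν μ > 0` the scalar of the fibration theorem,
`c • ∫_G f dμ = ∫_ℂ e^{-2 Im ζ} • (∫_K f (n_{Re ζ} a_{Im ζ} k) dk) dζ` — i.e.
`dg = e^{-2t} ds dt dk` for `g = n_s a_t k`. -/
theorem integral_haar (μ : Measure SU11) [IsHaarMeasure μ] {E : Type*} [NormedAddCommGroup E]
    [NormedSpace ℝ E] [CompleteSpace E] (f : SU11 → E) (hf : Integrable f μ) :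
    (haarScalarFactor (nu μC) μ : ℝ) • ∫ g, f g ∂μ =
      ∫ ζ : ℂ, Real.exp (-(2 * ζ.im)) • ∫ u, f (unip ζ.re * hyp ζ.im * rot u) ∂μC := by
  set c := haarScalarFactor (nu μC) μ with hc
  have hnu : nu μC = c • μ := nu_eq_smul μC μ
  have hint : Integrable f (nu μC) := by
    rw [hnu]
    exact hf.smul_measure ENNReal.coe_ne_top
  have h1 : ∫ g, f g ∂(nu μC) = (c : ℝ) • ∫ g, f g ∂μ := by
    rw [hnu, integral_smul_nnreal_measure, NNReal.smul_def]
  rw [← h1, integral_nu μC f hint]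

end measure

end Summit.Ventures.HodgeRepro2.T5SU11IwasawaHaar
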